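import Literature.Barriers.RiemannHypothesis.DeBrangesPositivityDirichletHE
import Literature.Analysis.ValidatedNumerics.IntervalLogArctan
import HarnessLib

/-!
# Certificate for Conrey–Li's numerical witness `Re{ξ(1+8714.2i, χ₄)/ξ(2+8714.2i, χ₄)} < 0`

LABEL (line 1): RH-FREE NEGATIVE result, now PROVED (certified numerics, one compiled evaluation):
the printed witness of the failure of de Branges' `𝓕(W_{χ₄})`-positivity condition (3.8).
bears_on: B-C/B-P (LADDER-RH §1, COLUMN 6 DBR). WHAT THIS IS NOT: not progress toward RH or GRH
in either direction — it certifies one printed inequality; the failure of (3.8) itself is already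
the numerics-free tree theorem `ConreyLi2000_FW_char_holds` (Sarnak), and nothing here bears on
the truth of RH.

Barrier catalogue `Literature/Barriers/RiemannHypothesis/`, sibling of
`DeBrangesPositivityDirichlet.lean` (the typed facts), `DeBrangesPositivityDirichletProofs.lean`
(Sarnak's all-`χ` refutation) and `DeBrangesPositivityDirichletHE.lean` (the `𝓗(E_{χ₄})` entry).
This file DISCHARGES the named fact
`Literature.Barriers.RiemannHypothesis.ConreyLi2000_FW_chi4_numeric` (Conrey–Li 2000, §3.2:
`Re{ξ(1 + i8714.2, χ₄)/ξ(2 + i8714.2, χ₄)} = −0.000422340607 < 0`, a MATHEMATICA evaluation in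
the source) exactly as the `ζ` entry `ConreyLi2000_FW_numeric` was discharged in
`DeBrangesPositivityCert.lean`: an executable checker `ConreyLi2000Chi4FWCert.check : Bool` on
the tree's verified multi-precision interval arithmetic, a soundness theorem
`ConreyLi2000Chi4FWCert.numeric_of_check : check = true → ConreyLi2000_FW_chi4_numeric`, and
one compiled evaluation `ConreyLi2000Chi4FWCert.check_eq_true` (`native_decide`; the only
non-standard axiom of this file is its auxiliary axiom — trust in the Lean compiler, the
`Lean.ofReduceBool`/`Lean.trustCompiler` family — declared to the gate as `computational`, as
for `DeBrangesPositivityCert.lean` and `MertensCertificate/Chunk*.lean`; the Euler–Maclaurin sums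
here have `N = 4096` terms at height `8714`, out of reach of kernel reduction).

## The reduction (proved here)

With `s = 1 + 8714.2i`, `w₀ = (s+1)/2 = 1 + 4357.1i`, `w₁ = (s+2)/2 = w₀ + ½`, and
`ξ(s, χ₄) = A(s) L(s, χ₄)`, `A(s) = 4^{(s+1)/2} Γ_ℝ(s+1) = 4^{w₀} π^{−w₀} Γ(w₀)`
(`xiFactorChi4`, `dirichletXi_eq_xiFactorChi4_mul` of `DeBrangesPositivityDirichletHE.lean`):
`A(s+1) = A(s) · (4/π)^{1/2} · Γ(w₁)/Γ(w₀)`. By the second-order Stirling form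
`Γ(w₁) = Γ(w₀) exp(F(w₁) − F(w₀) + E)`, `F(w) = (w−½)Log w − w`,
`‖E‖ ≤ 1/(6·4357.1³) + π/(12·4357.1²) ≤ 1/(7·10⁷)`
(`Literature.Analysis.SpecialFunctions.Complex.Gamma_eq_mul_exp_stirlingPrim_horizontal`), and
since positive real factors do not change the sign of a real part,

  `sign Re{ξ(s)/ξ(s+1)} = sign Re{e^{iθ} · L(s, χ₄) · conj L(s+1, χ₄) · e^{−i Im E}}`,
  `θ = −Im(F(w₁) − F(w₀))`

(`xi_mul_conj_xi`). The checker encloses `F(w₀)`, `F(w₁)` directly from the definition of `F`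
(`MC.logUpper`: principal logarithm of a box in the upper half-plane), `e^{iθ}` (`MC.expI`), and
`L(σ + 8714.2i, χ₄)`, `σ = 1, 2`, by the certified evaluator
`Literature.NumberTheory.LFunctions.HurwitzNumerics.lchi4Eval` (`4^{-s}(ζ(s,¼) − ζ(s,¾))`,
Euler–Maclaurin with `N = 4096`, `ν = 16`, scale `2^64`), and accepts iff `hi(Re W) < 0` and
`7·10⁷ · hi(Re W) + 2 · absHi(Im W) < 0` for the box `W ∋ V = e^{iθ} L(s) conj L(s+1)`, which
implies `Re(V e^{iy}) < 0` for every `|y| ≤ 1/(7·10⁷)` (`re_neg_of_check`). Numerically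
`L(1+8714.2i, χ₄) ≈ 0.6953 − 1.0531i`, `L(2+8714.2i, χ₄) ≈ 1.0535 − 0.1863i`, `θ ≈ −0.785312`,
`V ≈ −0.0360 − 1.3496i`, i.e. `Re V/|V| ≈ −0.0267` against the tolerance `2.9·10⁻⁸`; with
`|ξ(s)/ξ(s+1)| = 0.01583` this is the printed `Re = −4.2234·10⁻⁴`.

## Main results (namespace `Literature.Barriers.RiemannHypothesis`)

* `ConreyLi2000Chi4FWCert.xi_mul_conj_xi` (the reduction), `ConreyLi2000Chi4FWCert.check`,
  `ConreyLi2000Chi4FWCert.numeric_of_check` (soundness), `ConreyLi2000Chi4FWCert.check_eq_true`.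
* `ConreyLi2000_FW_chi4_numeric_holds : ConreyLi2000_FW_chi4_numeric`.

## References

* [ConreyLi2000] J. B. Conrey, X.-J. Li, *A note on some positivity conditions related to zeta and
  L-functions*, IMRN 2000, no. 18, 929–940; arXiv:math/9812166, §3.2
  (`Re{ξ(1+i8714.2, χ₄)/ξ(2+i8714.2, χ₄)} = −0.000422340607`).
* [MontgomeryVaughan2007] H. L. Montgomery, R. C. Vaughan, *Multiplicative Number Theory I*,
  §10.1 (10.13), (10.19) (`L(s, χ)` through Hurwitz zeta; the completed `ξ(s, χ)`).
* [Johansson2014] F. Johansson, Numer. Algorithms 69 (2015), §2 (rigorous Euler–Maclaurin for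
  `ζ(s, a)`).
-/

open Complex
open Literature.NumberTheory.LFunctions.DirichletTheta (dirichletXi)
open Literature.NumberTheory.LFunctions.HurwitzNumerics (lchi4Eval mem_lchi4Eval)
open Literature.Analysis.SpecialFunctions.Complex (stirlingPrim
  Gamma_eq_mul_exp_stirlingPrim_horizontal)
open Literature.Analysis.ValidatedNumerics.NumericsMP
open scoped ComplexConjugate

namespace Literature.Barriers.RiemannHypothesis

namespace ConreyLi2000Chi4FWCert

/-! ## The reduction to a phase -/

/-- `8714.2 = 43571/5`. [folklore] -/
private lemma T_eq : (8714.2 : ℝ) = 43571 / 5 := by norm_num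

/-- `s₁ = 1 + 8714.2 i`. [cite: ConreyLi2000, §3.2] -/
noncomputable def s₁ : ℂ := 1 + ((43571 / 5 : ℝ) : ℂ) * I

/-- `s₂ = s₁ + 1 = 2 + 8714.2 i`. [cite: ConreyLi2000, §3.2] -/
noncomputable def s₂ : ℂ := 2 + ((43571 / 5 : ℝ) : ℂ) * I

/-- `w₀ = (s₁+1)/2 = 1 + 4357.1 i`. [folklore] -/
noncomputable def w₀ : ℂ := 1 + ((43571 / 10 : ℝ) : ℂ) * I

/-- `w₁ = (s₂+1)/2 = 3/2 + 4357.1 i = w₀ + ½`. [folklore] -/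
noncomputable def w₁ : ℂ := 3 / 2 + ((43571 / 10 : ℝ) : ℂ) * I

/-- `ΔF = F(w₁) − F(w₀)`, `F = stirlingPrim` (the Stirling main term of
`log Γ(w₁) − log Γ(w₀)`). [folklore] -/
noncomputable def deltaF : ℂ := stirlingPrim w₁ - stirlingPrim w₀

/-- `cexp (conj z) = e^{Re z} · e^{−i Im z}`. [folklore] -/
private lemma exp_conj_eq (z : ℂ) :
    cexp (conj z) = (Real.exp z.re : ℂ) * cexp (↑(-z.im) * I) := by
  rw [Complex.ofReal_exp, ← Complex.exp_add]
  congr 1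
  apply Complex.ext <;> simp

/-- `Re(z/w) = Re(z · conj w)/|w|²`. [folklore] -/
private lemma div_re_eq (z w : ℂ) : (z / w).re = (z * conj w).re / Complex.normSq w := by
  rw [div_eq_mul_inv, Complex.inv_def, ← mul_assoc, Complex.re_mul_ofReal, div_eq_mul_inv]

/-- **The reduction.** For `s = 1 + 8714.2i` and the primitive character `χ` mod `4` there are
`E` with `‖E‖ ≤ 1/(7·10⁷)` (the Stirling remainder of `log Γ(w₁) − log Γ(w₀)`) and a real `p > 0`
with `ξ(s, χ) · conj ξ(s+1, χ) = p · e^{−i Im ΔF} · L(s, χ) · conj L(s+1, χ) · e^{−i Im E}`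
(`ξ(s, χ) = 4^{w₀} π^{−w₀} Γ(w₀) L(s, χ)`, `Γ(w₁) = Γ(w₀) e^{ΔF + E}`, `4^{w₁} = 4^{w₀} 4^{1/2}`,
`π^{−w₁} = π^{−w₀} π^{−1/2}`). [cite: ConreyLi2000, §3.2] -/
theorem xi_mul_conj_xi {χ : DirichletCharacter ℂ 4} (hχ : χ.IsPrimitive) :
    ∃ E : ℂ, ‖E‖ ≤ 1 / 70000000 ∧ ∃ p : ℝ, 0 < p ∧
      dirichletXi χ s₁ * conj (dirichletXi χ s₂) =
        (p : ℂ) * (cexp (↑(-deltaF.im) * I) * χ.LFunction s₁ * conj (χ.LFunction s₂) *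
          cexp (↑(-E.im) * I)) := by
  -- Stirling for `Γ(w₁)/Γ(w₀)`
  have him₀ : w₀.im = 43571 / 10 := by simp [w₀]
  obtain ⟨E, hE, hΓ⟩ := Gamma_eq_mul_exp_stirlingPrim_horizontal (w₀ := w₀) (δ := 1 / 2)
    (by simp [w₀]) (by rw [him₀]; norm_num) (by norm_num)
  have hw : w₀ + ((1 / 2 : ℝ) : ℂ) = w₁ := by unfold w₀ w₁; push_cast; ring
  rw [hw] at hΓ
  have hΓ' : Gamma w₁ = Gamma w₀ * cexp (deltaF + E) := by rw [hΓ]; rfl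
  have hEb : ‖E‖ ≤ 1 / 70000000 := by
    refine hE.trans ?_
    rw [him₀]
    have hπ := Real.pi_lt_d2
    have h1 : Real.pi / (12 * ((43571 / 10 : ℝ)) ^ 2) ≤ 3.15 / (12 * ((43571 / 10 : ℝ)) ^ 2) :=
      div_le_div_of_nonneg_right hπ.le (by positivity)
    norm_num at h1 ⊢
    linarith
  -- the two values of `ξ`
  have hre₁ : (-1 : ℝ) < s₁.re := by simp [s₁]
  have hre₂ : (-1 : ℝ) < s₂.re := by norm_num [s₂]
  have hw₀ : (s₁ + 1) / 2 = w₀ := by unfold s₁ w₀; push_cast; ring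
  have hw₁ : (s₂ + 1) / 2 = w₁ := by unfold s₂ w₁; push_cast; ring
  have hA₁ : xiFactorChi4 s₁ = (4 : ℂ) ^ w₀ * ((Real.pi : ℂ) ^ (-w₀) * Gamma w₀) := by
    rw [xiFactorChi4, Gammaℝ_def, neg_div, hw₀]
  have hA₂ : xiFactorChi4 s₂ = (4 : ℂ) ^ w₁ * ((Real.pi : ℂ) ^ (-w₁) * Gamma w₁) := by
    rw [xiFactorChi4, Gammaℝ_def, neg_div, hw₁]
  have hξ₁ : dirichletXi χ s₁ = xiFactorChi4 s₁ * χ.LFunction s₁ :=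
    dirichletXi_eq_xiFactorChi4_mul hχ hre₁
  have hξ₂ : dirichletXi χ s₂ = xiFactorChi4 s₂ * χ.LFunction s₂ :=
    dirichletXi_eq_xiFactorChi4_mul hχ hre₂
  -- `4^{w₁} = 4^{w₀} · 4^{1/2}`, `π^{-w₁} = π^{-w₀} · π^{-1/2}`: positive real extra factors
  have hπ0 : (Real.pi : ℂ) ≠ 0 := ofReal_ne_zero.2 Real.pi_ne_zero
  have h40 : (4 : ℂ) ≠ 0 := by norm_num
  set q : ℝ := Real.pi ^ (-(1 / 2) : ℝ) with hq
  have hq0 : 0 < q := Real.rpow_pos_of_pos Real.pi_pos _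
  set r : ℝ := (4 : ℝ) ^ ((1 / 2) : ℝ) with hr
  have hr0 : 0 < r := Real.rpow_pos_of_pos (by norm_num) _
  have hw01 : w₁ = w₀ + (1 / 2 : ℂ) := by rw [← hw]; push_cast; ring
  have hcpowπ : (Real.pi : ℂ) ^ (-w₁) = (Real.pi : ℂ) ^ (-w₀) * (q : ℂ) := by
    have e : -w₁ = -w₀ + (-(1 / 2) : ℂ) := by rw [hw01]; ring
    rw [e, cpow_add _ _ hπ0, hq, ofReal_cpow Real.pi_pos.le]
    push_cast
    ring
  have hcpow4 : (4 : ℂ) ^ w₁ = (4 : ℂ) ^ w₀ * (r : ℂ) := by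
    rw [hw01, cpow_add _ _ h40, hr, ofReal_cpow (by norm_num : (0 : ℝ) ≤ 4)]
    push_cast
    ring
  -- `A(s₁) ≠ 0` and `A(s₂) = A(s₁) · r q e^{ΔF + E}`
  have hAne : xiFactorChi4 s₁ ≠ 0 := by
    have hG : Gamma w₀ ≠ 0 := Complex.Gamma_ne_zero fun m h ↦ by
      have := congrArg Complex.im h
      rw [him₀] at this
      norm_num at this
    have hP : (Real.pi : ℂ) ^ (-w₀) ≠ 0 := fun h ↦ hπ0 ((cpow_eq_zero_iff _ _).1 h).1
    have h4 : (4 : ℂ) ^ w₀ ≠ 0 := fun h ↦ h40 ((cpow_eq_zero_iff _ _).1 h).1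
    rw [hA₁]
    exact mul_ne_zero h4 (mul_ne_zero hP hG)
  have hA₂' : xiFactorChi4 s₂ = xiFactorChi4 s₁ * ((r : ℂ) * (q : ℂ) * cexp (deltaF + E)) := by
    rw [hA₂, hcpow4, hcpowπ, hΓ', hA₁]
    ring
  -- the phases
  have hsplit : cexp (↑(-(deltaF + E).im) * I) =
      cexp (↑(-deltaF.im) * I) * cexp (↑(-E.im) * I) := by
    rw [← Complex.exp_add]
    congr 1
    push_cast
    simp only [Complex.add_im]
    push_cast
    ring
  refine ⟨E, hEb, Complex.normSq (xiFactorChi4 s₁) * (r * q) * Real.exp ((deltaF + E).re),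
    mul_pos (mul_pos (Complex.normSq_pos.2 hAne) (mul_pos hr0 hq0)) (Real.exp_pos _), ?_⟩
  calc dirichletXi χ s₁ * conj (dirichletXi χ s₂)
      = (xiFactorChi4 s₁ * conj (xiFactorChi4 s₁)) * ((r : ℂ) * (q : ℂ)) *
          cexp (conj (deltaF + E)) * (χ.LFunction s₁ * conj (χ.LFunction s₂)) := by
        rw [hξ₁, hξ₂, hA₂']
        simp only [map_mul, Complex.conj_ofReal, ← Complex.exp_conj]
        ring
    _ = (Complex.normSq (xiFactorChi4 s₁) : ℂ) * ((r : ℂ) * (q : ℂ)) *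
          ((Real.exp (deltaF + E).re : ℂ) *
            (cexp (↑(-deltaF.im) * I) * cexp (↑(-E.im) * I))) *
          (χ.LFunction s₁ * conj (χ.LFunction s₂)) := by
        rw [Complex.mul_conj, exp_conj_eq, hsplit]
    _ = _ := by
        push_cast
        ring

/-! ## The checker -/

/-- Scale `2^64`. [folklore] -/
def S : ℕ := 2 ^ 64

/-- Enclosure of `π` at scale `S` (Machin, `30` terms). [folklore] -/
def piBox : Option MI := MI.pi S 30

/-- The input box of `σ + 8714.2 i = σ + (43571/5) i`. [folklore] -/
def sBox (σ : ℤ) : MC := ⟨MI.ofInt S σ, MI.ofFrac S 43571 5⟩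

/-- The box of `w₀ = 1 + (43571/10) i`. [folklore] -/
def w0Box : MC := ⟨MI.ofInt S 1, MI.ofFrac S 43571 10⟩

/-- The box of `w₁ = 3/2 + (43571/10) i`. [folklore] -/
def w1Box : MC := ⟨MI.ofFrac S 3 2, MI.ofFrac S 43571 10⟩

/-- The box of `½`. [folklore] -/
def halfBox : MC := ⟨MI.ofFrac S 1 2, MI.ofInt S 0⟩

/-- Enclosure of `F(w) = (w − ½) Log w − w` for a box `W` in the upper half-plane (`80` series
terms for `log`/`arctan`; principal logarithm `MC.logUpper`). [folklore] -/
def stirlingBox (piI : MI) (W : MC) : Option MC :=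
  match MC.logUpper S 80 piI W with
  | some L => some ((MC.mul S (W.sub halfBox) L).sub W)
  | none => none

/-- Enclosure of the phase `θ = −Im(F(w₁) − F(w₀))`. [folklore] -/
def thetaBox (piI : MI) : Option MI :=
  match stirlingBox piI w1Box, stirlingBox piI w0Box with
  | some F₁, some F₀ => some (F₁.sub F₀).im.neg
  | _, _ => none

/-- Evaluation of `L(·, χ₄)` on a box: `lchi4Eval` at scale `2^64`, Euler–Maclaurin truncation
point `N = 4096` with `ν = 16` corrections, logarithms with `8` guard bits (`80` series terms,
Machin with `20` terms), `14` Taylor terms and `8` halvings for `exp`/`expI`. [folklore] -/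
def evalL (B : MC) : Option MC := lchi4Eval S 4096 16 8 80 20 14 8 14 8 B

/-- Enclosure `W` of `V = e^{iθ} · L₁ · conj L₂` from an enclosure `P ∋ π` and boxes `Z₁ ∋ L₁`,
`Z₂ ∋ L₂` (parameters, so that no proof ever reduces a closed numeric term). [folklore] -/
def wBoxWith (P : MI) (Z₁ Z₂ : MC) : Option MC :=
  match thetaBox P with
  | some Θ =>
    match MC.expI S 14 8 P Θ with
    | some PH => some (MC.mul S (MC.mul S PH Z₁) (MC.conj Z₂))
    | none => none
  | none => none

/-- The test on the box `W ∋ V`: `hi(Re W) < 0` and `7·10⁷ · hi(Re W) + 2 · absHi(Im W) < 0`.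
[folklore] -/
def checkWith (P : MI) (Z₁ Z₂ : MC) : Bool :=
  match wBoxWith P Z₁ Z₂ with
  | some W => decide (W.re.hi < 0) && decide (W.re.hi * 70000000 + 2 * W.im.absHi < 0)
  | none => false

/-- **The check** (made irreducible at the end of this file: never evaluate it by reduction):
`checkWith` on the computed `π` and the two computed boxes of `L(1+8714.2i, χ₄)`,
`L(2+8714.2i, χ₄)` (written with `Option.bind`/`map`/`getD`, not a `match`, so that the soundness
proof extracts the three boxes by rewriting lemmas and no definitional unfolding of a closed
numeric term ever reaches the kernel). [folklore] -/
def check : Bool :=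
  (piBox.bind fun P => (evalL (sBox 1)).bind fun Z₁ => (evalL (sBox 2)).map fun Z₂ =>
    checkWith P Z₁ Z₂).getD false

/-! ## Soundness -/

/-- `0 < S`. [folklore] -/
private lemma S_pos : 0 < S := by unfold S; positivity

/-- `σ + 8714.2 i ∈ sBox σ`. [folklore] -/
private lemma mem_sBox (σ : ℤ) : MC.mem S ((σ : ℂ) + ((43571 / 5 : ℝ) : ℂ) * I) (sBox σ) := by
  refine ⟨?_, ?_⟩
  · simpa [sBox] using MI.mem_ofInt S σ
  · simpa [sBox] using MI.mem_ofFrac S (43571 : ℤ) (q := 5) (by norm_num)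

/-- `s₁ ∈ sBox 1`, `s₂ ∈ sBox 2`. [folklore] -/
private lemma mem_sBox_one_two : MC.mem S s₁ (sBox 1) ∧ MC.mem S s₂ (sBox 2) :=
  ⟨by simpa [s₁] using mem_sBox 1, by simpa [s₂] using mem_sBox 2⟩

/-- `w₀ ∈ w0Box`. [folklore] -/
private lemma mem_w0Box : MC.mem S w₀ w0Box := by
  refine ⟨?_, ?_⟩
  · simpa [w₀, w0Box] using MI.mem_ofInt S 1
  · simpa [w₀, w0Box] using MI.mem_ofFrac S (43571 : ℤ) (q := 10) (by norm_num)

/-- `w₁ ∈ w1Box`. [folklore] -/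
private lemma mem_w1Box : MC.mem S w₁ w1Box := by
  refine ⟨?_, ?_⟩
  · simpa [w₁, w1Box] using MI.mem_ofFrac S (3 : ℤ) (q := 2) (by norm_num)
  · simpa [w₁, w1Box] using MI.mem_ofFrac S (43571 : ℤ) (q := 10) (by norm_num)

/-- `½ ∈ halfBox`. [folklore] -/
private lemma mem_halfBox : MC.mem S (1 / 2 : ℂ) halfBox := by
  refine ⟨?_, ?_⟩
  · simpa [halfBox] using MI.mem_ofFrac S (1 : ℤ) (q := 2) (by norm_num)
  · simpa [halfBox] using MI.mem_ofInt S 0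

/-- Soundness of `stirlingBox`: `F(w) ∈ stirlingBox W` for `w ∈ W`. [folklore] -/
private theorem mem_stirlingBox {piI : MI} (hpi : MI.mem S Real.pi piI) {w : ℂ} {W Y : MC}
    (hw : MC.mem S w W) (h : stirlingBox piI W = some Y) : MC.mem S (stirlingPrim w) Y := by
  unfold stirlingBox at h
  split at h
  · rename_i L hL
    simp only [Option.some.injEq] at h
    subst h
    have hlog := (MC.mem_logUpper S_pos hpi hL hw).2
    unfold stirlingPrim
    exact MC.mem_sub (MC.mem_mul S_pos (MC.mem_sub hw mem_halfBox) hlog) hw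
  · simp at h

/-- Soundness of `thetaBox`: `−Im ΔF ∈ Θ`. [folklore] -/
private theorem mem_thetaBox {piI : MI} (hpi : MI.mem S Real.pi piI) {Θ : MI}
    (h : thetaBox piI = some Θ) : MI.mem S (-deltaF.im) Θ := by
  unfold thetaBox at h
  split at h
  · rename_i F₁ F₀ hF₁ hF₀
    simp only [Option.some.injEq] at h
    subst h
    have hD := MC.mem_sub (mem_stirlingBox hpi mem_w1Box hF₁) (mem_stirlingBox hpi mem_w0Box hF₀)
    exact MI.mem_neg hD.2
  · simp at h

/-- Soundness of `wBoxWith`: `e^{−i Im ΔF} L₁ conj L₂ ∈ W`. [folklore] -/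
private theorem mem_wBoxWith {P : MI} (hpi : MI.mem S Real.pi P) {L₁ L₂ : ℂ} {Z₁ Z₂ : MC}
    (hz1 : MC.mem S L₁ Z₁) (hz2 : MC.mem S L₂ Z₂) {W : MC} (h : wBoxWith P Z₁ Z₂ = some W) :
    MC.mem S (cexp (↑(-deltaF.im) * I) * L₁ * conj L₂) W := by
  unfold wBoxWith at h
  split at h
  · rename_i Θ hΘ
    split at h
    · rename_i PH hPH
      simp only [Option.some.injEq] at h
      subst h
      have hph := MC.mem_expI S_pos hpi hPH (mem_thetaBox hpi hΘ)
      exact MC.mem_mul S_pos (MC.mem_mul S_pos hph hz1) (MC.mem_conj hz2)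
    · simp at h
  · simp at h

/-- **The test implies the sign, uniformly in a small rotation**: if `checkWith` accepts then
`Re(V · e^{iy}) < 0` for all `|y| ≤ 1/(7·10⁷)` (`cos y ≥ ½`, `|sin y| ≤ |y|`). [folklore] -/
private theorem re_neg_of_checkWith {P : MI} (hpi : MI.mem S Real.pi P) {L₁ L₂ : ℂ}
    {Z₁ Z₂ : MC} (hz1 : MC.mem S L₁ Z₁) (hz2 : MC.mem S L₂ Z₂) (h : checkWith P Z₁ Z₂ = true)
    (y : ℝ) (hy : |y| ≤ 1 / 70000000) :
    (cexp (↑(-deltaF.im) * I) * L₁ * conj L₂ * cexp (↑y * I)).re < 0 := by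
  unfold checkWith at h
  split at h
  · rename_i W hW
    have hV := mem_wBoxWith hpi hz1 hz2 hW
    set V : ℂ := cexp (↑(-deltaF.im) * I) * L₁ * conj L₂ with hVdef
    simp only [Bool.and_eq_true, decide_eq_true_eq] at h
    obtain ⟨h1, h2⟩ := h
    have hS : (0 : ℝ) < S := by exact_mod_cast S_pos
    have hVre : V.re * S ≤ W.re.hi := hV.1.2
    have hVim : |V.im| * S ≤ W.im.absHi := MI.abs_le_absHi hV.2
    have h1r : (W.re.hi : ℝ) < 0 := by exact_mod_cast h1
    have h2r : (W.re.hi : ℝ) * 70000000 + 2 * W.im.absHi < 0 := by exact_mod_cast h2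
    have hcos : 1 / 2 ≤ Real.cos y := by
      have hc := Real.one_sub_sq_div_two_le_cos (x := y)
      have hy1 : |y| ≤ 1 := hy.trans (by norm_num)
      have hy2 : y ^ 2 ≤ 1 := by
        have := abs_le.1 hy1
        nlinarith
      linarith
    have hsin : |Real.sin y| ≤ 1 / 70000000 := Real.abs_sin_le_abs.trans hy
    have hVneg : V.re < 0 := by
      by_contra hge
      push Not at hge
      have := mul_nonneg hge hS.le
      linarith
    have hre : (V * cexp (↑y * I)).re = V.re * Real.cos y - V.im * Real.sin y := by
      rw [Complex.mul_re, Complex.exp_ofReal_mul_I_re, Complex.exp_ofReal_mul_I_im]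
    have a1 : V.re * Real.cos y * S ≤ W.re.hi / 2 := by
      have : V.re * Real.cos y ≤ V.re * (1 / 2) := mul_le_mul_of_nonpos_left hcos hVneg.le
      nlinarith
    have a2 : -(V.im * Real.sin y) * S ≤ W.im.absHi / 70000000 := by
      have h3 : -(V.im * Real.sin y) ≤ |V.im| * (1 / 70000000) :=
        calc -(V.im * Real.sin y) ≤ |V.im * Real.sin y| := neg_le_abs _
          _ = |V.im| * |Real.sin y| := abs_mul _ _
          _ ≤ |V.im| * (1 / 70000000) := by gcongr
      nlinarith [abs_nonneg V.im]
    rw [hre]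
    by_contra hge
    push Not at hge
    have h4 : 0 ≤ (V.re * Real.cos y - V.im * Real.sin y) * S := mul_nonneg hge hS.le
    nlinarith
  · exact absurd h Bool.false_ne_true

/-- **Soundness of the certificate**: if `check` accepts then
`Re{ξ(1+8714.2i, χ)/ξ(2+8714.2i, χ)} < 0` for the primitive character `χ` mod `4`.
[cite: ConreyLi2000, §3.2] -/
theorem numeric_of_check (h : check = true) : ConreyLi2000_FW_chi4_numeric := by
  intro χ hχ
  rw [T_eq]
  change (dirichletXi χ s₁ / dirichletXi χ s₂).re < 0
  have h1 := ne_one_of_isPrimitive_four hχ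
  have hs1 : s₁ ≠ 1 := fun e ↦ by
    have := congrArg Complex.im e
    norm_num [s₁] at this
  have hs2 : s₂ ≠ 1 := fun e ↦ by
    have := congrArg Complex.im e
    norm_num [s₂] at this
  -- extract the three computed boxes without reducing them
  unfold check at h
  cases hP : piBox with
  | none =>
    rw [hP, Option.bind_none, Option.getD_none] at h
    exact absurd h Bool.false_ne_true
  | some P =>
    rw [hP, Option.bind_some] at h
    cases hZ1 : evalL (sBox 1) with
    | none =>
      rw [hZ1, Option.bind_none, Option.getD_none] at h
      exact absurd h Bool.false_ne_true
    | some Z₁ =>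
      rw [hZ1, Option.bind_some] at h
      cases hZ2 : evalL (sBox 2) with
      | none =>
        rw [hZ2, Option.map_none, Option.getD_none] at h
        exact absurd h Bool.false_ne_true
      | some Z₂ =>
        rw [hZ2, Option.map_some, Option.getD_some] at h
        have hpi : MI.mem S Real.pi P := MI.mem_pi S hP
        have hz1 := mem_lchi4Eval hχ mem_sBox_one_two.1 hs1 hZ1
        have hz2 := mem_lchi4Eval hχ mem_sBox_one_two.2 hs2 hZ2
        obtain ⟨E, hE, p, hp, hkey⟩ := xi_mul_conj_xi hχ
        have hy : |(-E.im)| ≤ 1 / 70000000 := by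
          rw [abs_neg]
          exact (Complex.abs_im_le_norm E).trans hE
        have hneg := re_neg_of_checkWith hpi hz1 hz2 h (-E.im) hy
        have hprod : (dirichletXi χ s₁ * conj (dirichletXi χ s₂)).re < 0 := by
          rw [hkey, Complex.re_ofReal_mul]
          exact mul_neg_of_pos_of_neg hp hneg
        have hξ₂ : dirichletXi χ s₂ ≠ 0 := fun h0 ↦ by
          rw [h0, map_zero, mul_zero, Complex.zero_re] at hprod
          exact lt_irrefl _ hprod
        rw [div_re_eq]
        exact div_neg_of_neg_of_pos hprod (Complex.normSq_pos.2 hξ₂)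

attribute [irreducible] piBox evalL check

/-! ## The compiled evaluation -/

/-- **The certificate accepts**: one compiled evaluation (`native_decide`) of `check` — two
certified Euler–Maclaurin evaluations of `L(·, χ₄)` through `ζ(s, ¼)`, `ζ(s, ¾)` with `4096`
terms each (`L(1+8714.2i, χ₄) ∈ 0.6953… − 1.0530…i`, `L(2+8714.2i, χ₄) ∈ 1.0535… − 0.1863…i`),
the phase `θ ∈ −0.785312…`, and the box `W ∋ V`, `W ≈ −0.03600 − 1.34960 i` (in units of
`2^-64`: `Re W ≤ −664200009808223027`, `|Im W| ≤ 24895708056269247967`), which passes both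
integer comparisons. The auxiliary axiom of `native_decide` (trust in the Lean compiler) is the
only non-standard axiom; declared `computational`. [cite: ConreyLi2000, §3.2] -/
theorem check_eq_true : check = true := by
  native_decide

end ConreyLi2000Chi4FWCert

/-- **Conrey–Li 2000, §3.2, certified**: `Re{ξ(1 + 8714.2i, χ₄)/ξ(2 + 8714.2i, χ₄)} < 0` — the
named fact `ConreyLi2000_FW_chi4_numeric` DISCHARGED by the certificate
`ConreyLi2000Chi4FWCert.check_eq_true` and its soundness theorem
`ConreyLi2000Chi4FWCert.numeric_of_check`. (Hence once more, for `r = 4`, the `𝓕(W_χ)` failure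
via `ConreyLi2000_FW_char_four_of_numeric`; the all-`χ`, numerics-free theorem is
`ConreyLi2000_FW_char_holds`.) [cite: ConreyLi2000, §3.2] -/
theorem ConreyLi2000_FW_chi4_numeric_holds : ConreyLi2000_FW_chi4_numeric :=
  ConreyLi2000Chi4FWCert.numeric_of_check ConreyLi2000Chi4FWCert.check_eq_true

end Literature.Barriers.RiemannHypothesis
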